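/-
Copyright: b2b-lace packet (tail-bound analyst, gen 5). Kernel node N68b, Fourier half (LEMMAS §20):
the NBW polynomials `P_m` and the identity `b̂_m(k) = P_m(2d D̂(k))` for the non-backtracking walk
counts `b_m(x)` on `ℤ^d`, proved from the two-step recursion (`NbwTwoStepRecursion.lean`).
-/
import Literature.Probability.FitznerVanDerHofstad2017.NbwTwoStepRecursion
import Literature.Probability.FitznerVanDerHofstad2017.SrwLawParity
import HarnessLib

/-!
# The NBW polynomials and `b̂_m(k) = P_m(2dD̂(k))`

`b_m(x) = |nbwWordsTo d m x|` is the number of `m`-step nearest-neighbour walks `0 → x` on `ℤ^d`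
without immediate reversals ([HvdH17] §10.2).  Its generating function is the non-backtracking walk
two-point function, solved in Fourier space in [FvdH-NoBLE] §1.2.2 (1.21) (arXiv numbering) and in
[MadrasSlade1993] Cor. 5.3.2 (5.3.3):

  `B̂_z(k) = Σ_m b̂_m(k) zᵐ = (1 - z²)/(1 + (2d-1)z² - 2dz D̂(k))`.

Coefficient by coefficient this says `b̂_m(k) = P_m(A)`, `A = 2dD̂(k)`, with the **NBW polynomials**

  `P_0 = 1`, `P_1 = A`, `P_2 = A² - 2d`, `P_{m+3} = A·P_{m+2} - (2d-1)·P_{m+1}`   (`nbwPoly`),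

and back in `x`-space the two-step recursion `b_1 = 2dD ⋆ b_0`, `b_2 = 2dD ⋆ b_1 - 2d·b_0`,
`b_{m+3} = 2dD ⋆ b_{m+2} - (2d-1)·b_{m+1}` — the tree theorems `card_nbwWordsTo_one`,
`card_nbwWordsTo_two_step_zero`, `card_nbwWordsTo_two_step` of `NbwTwoStepRecursion.lean`
(b2b-lace carver), proved there by appending the last step.  This module proves the Fourier
identity in its `x`-space form

  `b_m(y) = (2π)^{-d} ∫_{[-π,π]^d} P_m(2dD̂(k)) cos(k·y) dk`        (`nbwP_eq_card_nbwWordsTo`)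

for every `d`, `m` and `y ∈ ℤ^d`, by showing that the right-hand side (`nbwP`) obeys the same
recursion (product-to-sum under the integral, tree theorem `Dhat_mul_cos_kdot`) with the same initial
values (`srwP_zero`); and the expansion of any polynomial kernel in the SRW transition functions
`p_i = srwP d i`, `(2π)^{-d} ∫ p(2dD̂) cos(k·y) dk = Σ_i [p]_i (2d)^i p_i(y)` (`polyFourier_eq_sum_srwP`),
whence `b_m(y) = Σ_i [P_m]_i (2d)^i p_i(y)` (`card_nbwWordsTo_eq_sum_coeff_srwP`).

Consumers (b2b-lace LEMMAS §20, N68c–e): `nbwPoly d m` is the kernel `P_m` of the NBW-kernel remainder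
`nbwJ d n (Π_i P_{c_i})` of `NbwRemainderKernel.lean`; its defining equations `nbwPoly_zero/one/two/
add_three` are the `IsNbwPolySeq` interface of the Chebyshev closed form.  No statement about any
dimension is made here.
-/

namespace Literature.Probability.FitznerVanDerHofstad2017

open MeasureTheory Real Finset
open scoped BigOperators
open Literature.Barriers.CriticalPhenomena
open Literature.Barriers.CriticalPhenomena.Slade2006Prop53 (P)
open Literature.Probability.LatticeModels
open Literature.Probability.Percolation

variable {d : ℕ}

/-! ### The two-step recursion over `ℝ`, in the `± e_j` form -/

/-- The sum over the `2d` unit steps as `Σ_j [f(x + e_j) + f(x - e_j)]`. [folklore] -/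
theorem sum_stepVec_sub_eq {M : Type*} [AddCommMonoid M] (f : Site d → M) (x : Site d) :
    ∑ s : Fin d × Bool, f (x - stepVec s) =
      ∑ j : Fin d, (f (x + axisVec j 1) + f (x - axisVec j 1)) := by
  rw [Fintype.sum_prod_type]
  refine Finset.sum_congr rfl fun j _ => ?_
  rw [Fintype.sum_bool, add_comm]
  have h : (axisVec j 1 : Site d) = Pi.single j 1 := by
    funext i
    simp [axisVec, Pi.single_apply]
  simp only [stepVec, h, if_true, Bool.false_eq_true, if_false, sub_neg_eq_add]

/-- The recursion coefficient `c_0 = 2d`, `c_m = 2d - 1` (`m ≥ 1`): the number of non-backtracking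
continuations of a walk of length `m`.
[cite: MadrasSlade1993, §1.1 p. 3 (no immediate reversals: 2d choices, then 2d-1; 2d(2d-1)^{N-1}, above (1.1.1))] -/
noncomputable def nbwCoefR (d : ℕ) : ℕ → ℝ
  | 0 => 2 * d
  | _ + 1 => 2 * d - 1

/-- `c_0 = 2d`. [folklore] -/
@[simp] theorem nbwCoefR_zero : nbwCoefR d 0 = 2 * d := rfl

/-- `c_{m+1} = 2d - 1`. [folklore] -/
@[simp] theorem nbwCoefR_succ (m : ℕ) : nbwCoefR d (m + 1) = 2 * d - 1 := rfl

/-- `b_0 = δ_0` over `ℝ`. [folklore] -/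
theorem card_nbwWordsTo_zero_real (x : Site d) :
    ((nbwWordsTo d 0 x).card : ℝ) = if x = 0 then 1 else 0 := by
  rw [card_nbwWordsTo_zero]
  split_ifs <;> simp

/-- `b_1(x) = Σ_j [b_0(x + e_j) + b_0(x - e_j)]` over `ℝ`.
[cite: FitznerVanDerHofstad2016NoBLE, §1.2.2 (1.21) (arXiv numbering; coefficient of z)] -/
theorem card_nbwWordsTo_one_real (x : Site d) :
    ((nbwWordsTo d 1 x).card : ℝ) =
      ∑ j : Fin d, (((nbwWordsTo d 0 (x + axisVec j 1)).card : ℝ) +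
        (nbwWordsTo d 0 (x - axisVec j 1)).card) := by
  rw [card_nbwWordsTo_one, Nat.cast_sum,
    sum_stepVec_sub_eq (fun y => ((nbwWordsTo d 0 y).card : ℝ))]

/-- In dimension `0` there are no steps, hence no walks of positive length. [folklore] -/
theorem card_nbwWordsTo_dim_zero (n : ℕ) (x : Site 0) : (nbwWordsTo 0 (n + 1) x).card = 0 := by
  have hE : IsEmpty (Fin (n + 1) → Fin 0 × Bool) := ⟨fun f => (f ⟨0, by omega⟩).1.elim0⟩
  rw [Finset.eq_empty_of_isEmpty (nbwWordsTo 0 (n + 1) x), Finset.card_empty]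

/-- **The NBW two-step recursion** over `ℝ`, all cases in one line:
`b_{m+2}(x) = Σ_j [b_{m+1}(x + e_j) + b_{m+1}(x - e_j)] - c_m·b_m(x)`, `c_0 = 2d`, `c_m = 2d - 1`.
[cite: FitznerVanDerHofstad2016NoBLE, §1.2.2 (1.21) (arXiv numbering)]
[cite: MadrasSlade1993, Cor. 5.3.2 (5.3.3) p. 134] -/
theorem card_nbwWordsTo_add_two_real (m : ℕ) (x : Site d) :
    ((nbwWordsTo d (m + 2) x).card : ℝ) =
      ∑ j : Fin d, (((nbwWordsTo d (m + 1) (x + axisVec j 1)).card : ℝ) +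
          (nbwWordsTo d (m + 1) (x - axisVec j 1)).card)
        - nbwCoefR d m * (nbwWordsTo d m x).card := by
  rw [← sum_stepVec_sub_eq (fun y => ((nbwWordsTo d (m + 1) y).card : ℝ)), eq_sub_iff_add_eq]
  cases m with
  | zero =>
    have h := congrArg (Nat.cast : ℕ → ℝ) (card_nbwWordsTo_two_step_zero (d := d) x)
    push_cast at h
    simpa using h
  | succ m =>
    have h := congrArg (Nat.cast : ℕ → ℝ) (card_nbwWordsTo_two_step (d := d) m x)
    push_cast at h
    have hc : ((2 * d - 1 : ℕ) : ℝ) * ((nbwWordsTo d (m + 1) x).card : ℝ) =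
        (2 * (d : ℝ) - 1) * ((nbwWordsTo d (m + 1) x).card : ℝ) := by
      rcases Nat.eq_zero_or_pos d with hd | hd
      · subst hd
        rw [card_nbwWordsTo_dim_zero, Nat.cast_zero, mul_zero, mul_zero]
      · rw [Nat.cast_sub (by omega : 1 ≤ 2 * d)]
        push_cast
        ring
    rw [show m + 1 + 2 = m + 3 from rfl, show m + 1 + 1 = m + 2 from rfl, nbwCoefR_succ]
    linarith [h, hc]

/-! ### Polynomials in `A = 2dD̂(k)` under the inverse Fourier integral -/

/-- `𝓕⁻¹[p(2dD̂)](y) = (2π)^{-d} ∫_{[-π,π]^d} p(2dD̂(k)) cos(k·y) dk` for a polynomial kernel `p`.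
[cite: FitznerVanDerHofstad2016NoBLE, §1.2.2 (1.21) (arXiv numbering; B̂_z(k) is rational in D̂(k))] -/
noncomputable def polyFourier (d : ℕ) (p : Polynomial ℝ) (y : Site d) : ℝ :=
  (∫ k, p.eval (2 * (d : ℝ) * Dhat d k) * Real.cos (kdot k y) ∂P d) / (2 * π) ^ d

/-- The kernel expanded in powers of `D̂`. [folklore] -/
theorem polyEval_mul_cos_eq_sum (p : Polynomial ℝ) (y : Site d) (k : Fin d → ℝ) :
    p.eval (2 * (d : ℝ) * Dhat d k) * Real.cos (kdot k y) =
      ∑ i ∈ Finset.range (p.natDegree + 1),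
        p.coeff i * (2 * (d : ℝ)) ^ i * (Dhat d k ^ i * Real.cos (kdot k y)) := by
  rw [Polynomial.eval_eq_sum_range, Finset.sum_mul]
  refine Finset.sum_congr rfl fun i _ => ?_
  rw [mul_pow]
  ring

/-- The kernel `p(2dD̂(k)) cos(k·y)` is integrable on the cube. [folklore] -/
theorem integrable_polyEval_mul_cos (p : Polynomial ℝ) (y : Site d) :
    Integrable (fun k => p.eval (2 * (d : ℝ) * Dhat d k) * Real.cos (kdot k y)) (P d) := by
  have h : (fun k => p.eval (2 * (d : ℝ) * Dhat d k) * Real.cos (kdot k y)) = fun k =>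
      ∑ i ∈ Finset.range (p.natDegree + 1),
        p.coeff i * (2 * (d : ℝ)) ^ i * (Dhat d k ^ i * Real.cos (kdot k y)) :=
    funext fun k => polyEval_mul_cos_eq_sum p y k
  rw [h]
  exact integrable_finsetSum _ fun i _ => (integrable_Dhat_pow_mul_cos i y).const_mul _

/-- **Expansion in SRW transition functions**: `𝓕⁻¹[p(2dD̂)](y) = Σ_i [p]_i (2d)^i p_i(y)` with
`p_i = srwP d i` the `i`-step SRW transition function.
[cite: FitznerVanDerHofstad2016NoBLE, §3.4 p. 1071 (p_i = D^{*i})] -/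
theorem polyFourier_eq_sum_srwP (p : Polynomial ℝ) (y : Site d) :
    polyFourier d p y =
      ∑ i ∈ Finset.range (p.natDegree + 1), p.coeff i * (2 * (d : ℝ)) ^ i * srwP d i y := by
  unfold polyFourier srwP
  simp_rw [polyEval_mul_cos_eq_sum p y]
  rw [integral_finsetSum _ fun i _ => (integrable_Dhat_pow_mul_cos i y).const_mul _,
    Finset.sum_div]
  refine Finset.sum_congr rfl fun i _ => ?_
  rw [integral_const_mul, mul_div_assoc]

/-- `2d·D̂(k) cos(k·y) = Σ_j [cos(k·(y + e_j)) + cos(k·(y - e_j))]` (product-to-sum; trivially also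
for `d = 0`). [folklore] -/
theorem two_d_mul_Dhat_mul_cos (k : Fin d → ℝ) (y : Site d) :
    2 * (d : ℝ) * Dhat d k * Real.cos (kdot k y) =
      ∑ j, (Real.cos (kdot k (y + axisVec j 1)) + Real.cos (kdot k (y - axisVec j 1))) := by
  rcases Nat.eq_zero_or_pos d with hd | hd
  · subst hd
    simp
  · have hd' : (0 : ℝ) < d := by exact_mod_cast hd
    rw [mul_assoc, Dhat_mul_cos_kdot]
    field_simp

/-- **Multiplication by `A = 2dD̂`** is the lattice step operator:
`𝓕⁻¹[A·p(A)](y) = Σ_j (𝓕⁻¹[p(A)](y + e_j) + 𝓕⁻¹[p(A)](y - e_j))`.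
[cite: FitznerVanDerHofstad2016NoBLE, §3.4 p. 1071 (p_{i+1} = D ⋆ p_i)] -/
theorem polyFourier_X_mul (p : Polynomial ℝ) (y : Site d) :
    polyFourier d (Polynomial.X * p) y =
      ∑ j, (polyFourier d p (y + axisVec j 1) + polyFourier d p (y - axisVec j 1)) := by
  unfold polyFourier
  have hpt : ∀ k, (Polynomial.X * p).eval (2 * (d : ℝ) * Dhat d k) * Real.cos (kdot k y) =
      ∑ j, (p.eval (2 * (d : ℝ) * Dhat d k) * Real.cos (kdot k (y + axisVec j 1)) +
        p.eval (2 * (d : ℝ) * Dhat d k) * Real.cos (kdot k (y - axisVec j 1))) := by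
    intro k
    rw [Polynomial.eval_mul, Polynomial.eval_X, mul_comm (2 * (d : ℝ) * Dhat d k), mul_assoc,
      two_d_mul_Dhat_mul_cos, Finset.mul_sum]
    simp only [mul_add]
  simp_rw [hpt]
  rw [integral_finsetSum _ (fun j _ => ?_)]
  swap
  · exact (integrable_polyEval_mul_cos p _).add (integrable_polyEval_mul_cos p _)
  simp_rw [integral_add (integrable_polyEval_mul_cos p _) (integrable_polyEval_mul_cos p _)]
  rw [Finset.sum_div]
  simp_rw [add_div]

/-- Linearity in the kernel: constants. [folklore] -/
theorem polyFourier_C_mul (c : ℝ) (p : Polynomial ℝ) (y : Site d) :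
    polyFourier d (Polynomial.C c * p) y = c * polyFourier d p y := by
  unfold polyFourier
  have h : ∀ k, (Polynomial.C c * p).eval (2 * (d : ℝ) * Dhat d k) * Real.cos (kdot k y) =
      c * (p.eval (2 * (d : ℝ) * Dhat d k) * Real.cos (kdot k y)) := by
    intro k
    rw [Polynomial.eval_mul, Polynomial.eval_C, mul_assoc]
  simp_rw [h]
  rw [integral_const_mul, mul_div_assoc]

/-- Linearity in the kernel: differences. [folklore] -/
theorem polyFourier_sub (p q : Polynomial ℝ) (y : Site d) :
    polyFourier d (p - q) y = polyFourier d p y - polyFourier d q y := by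
  unfold polyFourier
  simp_rw [Polynomial.eval_sub, sub_mul]
  rw [integral_sub (integrable_polyEval_mul_cos p y) (integrable_polyEval_mul_cos q y), sub_div]

/-- `𝓕⁻¹[1](y) = δ_0(y)` (orthogonality of the cosines on the cube).
[cite: HeydenreichVanDerHofstad2017, (1.2.17)] -/
theorem polyFourier_one (y : Site d) : polyFourier d 1 y = if y = 0 then 1 else 0 := by
  rw [← srwP_zero y]
  unfold polyFourier srwP
  simp_rw [Polynomial.eval_one, pow_zero]

/-! ### The NBW polynomials and `b̂_m = P_m(2dD̂)` -/

/-- **The NBW polynomials** `P_m(A)` (`A = 2dD̂(k)`): `P_0 = 1`, `P_1 = A`, `P_2 = A² - 2d`,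
`P_{m+3} = A·P_{m+2} - (2d-1)·P_{m+1}` — the coefficients of `zᵐ` in the non-backtracking walk
two-point function `B̂_z(k) = (1 - z²)/(1 + (2d-1)z² - zA)`.
[cite: FitznerVanDerHofstad2016NoBLE, §1.2.2 (1.21) (arXiv numbering)]
[cite: MadrasSlade1993, Cor. 5.3.2 (5.3.3) p. 134] -/
noncomputable def nbwPoly (d : ℕ) : ℕ → Polynomial ℝ
  | 0 => 1
  | 1 => Polynomial.X
  | 2 => Polynomial.X ^ 2 - Polynomial.C (2 * (d : ℝ))
  | m + 3 => Polynomial.X * nbwPoly d (m + 2) - Polynomial.C (2 * (d : ℝ) - 1) * nbwPoly d (m + 1)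

/-- `P_0 = 1`. [folklore] -/
@[simp] theorem nbwPoly_zero : nbwPoly d 0 = 1 := rfl

/-- `P_1 = A`. [folklore] -/
@[simp] theorem nbwPoly_one : nbwPoly d 1 = Polynomial.X := rfl

/-- `P_2 = A² - 2d`. [folklore] -/
theorem nbwPoly_two : nbwPoly d 2 = Polynomial.X ^ 2 - Polynomial.C (2 * (d : ℝ)) := rfl

/-- `P_{m+3} = A·P_{m+2} - (2d-1)·P_{m+1}`. [folklore] -/
theorem nbwPoly_add_three (m : ℕ) :
    nbwPoly d (m + 3) =
      Polynomial.X * nbwPoly d (m + 2) - Polynomial.C (2 * (d : ℝ) - 1) * nbwPoly d (m + 1) := rfl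

/-- The recursion in one line: `P_{m+2} = A·P_{m+1} - c_m·P_m` (`c_0 = 2d`, `c_m = 2d - 1`).
[folklore] -/
theorem nbwPoly_add_two (m : ℕ) :
    nbwPoly d (m + 2) =
      Polynomial.X * nbwPoly d (m + 1) - Polynomial.C (nbwCoefR d m) * nbwPoly d m := by
  cases m with
  | zero =>
    rw [show (0 : ℕ) + 2 = 2 from rfl, show (0 : ℕ) + 1 = 1 from rfl, nbwPoly_two, nbwPoly_one,
      nbwPoly_zero, nbwCoefR_zero, mul_one, pow_two]
  | succ m =>
    rw [show m + 1 + 2 = m + 3 from rfl, show m + 1 + 1 = m + 2 from rfl, nbwPoly_add_three,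
      nbwCoefR_succ]

/-- **Normalisation `P_{m+1}(2d) = 2d(2d-1)^m`** (the value at `k = 0`, `D̂(0) = 1`): the number of
`(m+1)`-step walks without immediate reversals — `2d` choices for the first step, `2d - 1` for each
later one. [cite: MadrasSlade1993, §1.1 p. 3 (2d(2d-1)^{N-1}, above (1.1.1))] -/
theorem nbwPoly_eval_two_d_succ (m : ℕ) :
    (nbwPoly d (m + 1)).eval (2 * (d : ℝ)) = 2 * (d : ℝ) * (2 * (d : ℝ) - 1) ^ m := by
  have key : ∀ n : ℕ, (nbwPoly d (n + 1)).eval (2 * (d : ℝ)) = 2 * (d : ℝ) * (2 * (d : ℝ) - 1) ^ n ∧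
      (nbwPoly d (n + 2)).eval (2 * (d : ℝ)) = 2 * (d : ℝ) * (2 * (d : ℝ) - 1) ^ (n + 1) := by
    intro n
    induction n with
    | zero =>
      refine ⟨by simp, ?_⟩
      rw [show (0 : ℕ) + 2 = 2 from rfl, nbwPoly_two, Polynomial.eval_sub, Polynomial.eval_pow,
        Polynomial.eval_X, Polynomial.eval_C]
      ring
    | succ n ih =>
      refine ⟨ih.2, ?_⟩
      rw [show n + 1 + 2 = n + 3 from rfl, nbwPoly_add_three, Polynomial.eval_sub,
        Polynomial.eval_mul, Polynomial.eval_mul, Polynomial.eval_X, Polynomial.eval_C,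
        show n + 1 + 1 = n + 2 from rfl, ih.1, ih.2]
      ring
  exact (key m).1

/-- `P_0(2d) = 1`. [folklore] -/
theorem nbwPoly_eval_two_d_zero : (nbwPoly d 0).eval (2 * (d : ℝ)) = 1 := by simp

/-- **`b_m` on the Fourier side**: `nbwP d m y = (2π)^{-d} ∫_{[-π,π]^d} P_m(2dD̂(k)) cos(k·y) dk`.
[cite: FitznerVanDerHofstad2016NoBLE, §1.2.2 (1.21) (arXiv numbering)] -/
noncomputable def nbwP (d m : ℕ) (y : Site d) : ℝ := polyFourier d (nbwPoly d m) y

/-- `nbwP` as the integral. [folklore] -/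
theorem nbwP_eq_integral (m : ℕ) (y : Site d) :
    nbwP d m y =
      (∫ k, (nbwPoly d m).eval (2 * (d : ℝ) * Dhat d k) * Real.cos (kdot k y) ∂P d) / (2 * π) ^ d :=
  rfl

/-- `𝓕⁻¹[P_0](y) = δ_0(y)`. [folklore] -/
theorem nbwP_zero (y : Site d) : nbwP d 0 y = if y = 0 then 1 else 0 := by
  rw [nbwP, nbwPoly_zero, polyFourier_one]

/-- `𝓕⁻¹[P_1](y) = Σ_j [δ_0(y + e_j) + δ_0(y - e_j)]`. [folklore] -/
theorem nbwP_one (y : Site d) :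
    nbwP d 1 y = ∑ j, (nbwP d 0 (y + axisVec j 1) + nbwP d 0 (y - axisVec j 1)) := by
  simp only [nbwP, nbwPoly_one, nbwPoly_zero]
  rw [← polyFourier_X_mul, mul_one]

/-- The Fourier side obeys the NBW recursion:
`𝓕⁻¹[P_{m+2}](y) = Σ_j (𝓕⁻¹[P_{m+1}](y + e_j) + 𝓕⁻¹[P_{m+1}](y - e_j)) - c_m·𝓕⁻¹[P_m](y)`. [folklore] -/
theorem nbwP_add_two (m : ℕ) (y : Site d) :
    nbwP d (m + 2) y =
      ∑ j, (nbwP d (m + 1) (y + axisVec j 1) + nbwP d (m + 1) (y - axisVec j 1))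
        - nbwCoefR d m * nbwP d m y := by
  simp only [nbwP]
  rw [nbwPoly_add_two, polyFourier_sub, polyFourier_X_mul, polyFourier_C_mul]

/-- **`b̂_m(k) = P_m(2dD̂(k))`**, in `x`-space: for every `d`, `m` and `y ∈ ℤ^d`,
`b_m(y) = (2π)^{-d} ∫_{[-π,π]^d} P_m(2dD̂(k)) cos(k·y) dk` — the number of `m`-step walks `0 → y`
without immediate reversals is the `y`-th Fourier coefficient of `P_m(2dD̂)` (the coefficient of
`zᵐ` in `B̂_z(k) = (1-z²)/(1+(2d-1)z²-2dzD̂(k))`).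
[cite: FitznerVanDerHofstad2016NoBLE, §1.2.2 (1.21) (arXiv numbering)]
[cite: MadrasSlade1993, Cor. 5.3.2 (5.3.3) p. 134] -/
theorem nbwP_eq_card_nbwWordsTo (m : ℕ) (y : Site d) :
    nbwP d m y = ((nbwWordsTo d m y).card : ℝ) := by
  have key : ∀ n : ℕ, (∀ y : Site d, nbwP d n y = ((nbwWordsTo d n y).card : ℝ)) ∧
      (∀ y : Site d, nbwP d (n + 1) y = ((nbwWordsTo d (n + 1) y).card : ℝ)) := by
    intro n
    induction n with
    | zero =>
      have h0 : ∀ y : Site d, nbwP d 0 y = ((nbwWordsTo d 0 y).card : ℝ) := fun y => by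
        rw [nbwP_zero, card_nbwWordsTo_zero_real]
      refine ⟨h0, fun y => ?_⟩
      rw [show (0 : ℕ) + 1 = 1 from rfl, nbwP_one, card_nbwWordsTo_one_real]
      simp only [h0]
    | succ n ih =>
      refine ⟨ih.2, fun y => ?_⟩
      rw [show n + 1 + 1 = n + 2 from rfl, nbwP_add_two, card_nbwWordsTo_add_two_real]
      simp only [ih.1, ih.2]
  exact (key m).1 y

/-- The same with the integral written out:
`|nbwWordsTo d m y| = (2π)^{-d} ∫_{[-π,π]^d} P_m(2dD̂(k)) cos(k·y) dk`.
[cite: FitznerVanDerHofstad2016NoBLE, §1.2.2 (1.21) (arXiv numbering)] -/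
theorem card_nbwWordsTo_eq_integral_nbwPoly (m : ℕ) (y : Site d) :
    ((nbwWordsTo d m y).card : ℝ) =
      (∫ k, (nbwPoly d m).eval (2 * (d : ℝ) * Dhat d k) * Real.cos (kdot k y) ∂P d) / (2 * π) ^ d := by
  rw [← nbwP_eq_card_nbwWordsTo, nbwP_eq_integral]

/-- **`b_m(y) = Σ_i [P_m]_i (2d)^i p_i(y)`**: the NBW count as a finite combination of SRW
transition functions — the form in which NBW kernels are evaluated from the certified SRW tables.
[cite: FitznerVanDerHofstad2016NoBLE, §1.2.2 (1.21)–(1.22) (arXiv numbering; B̂_z in terms of the SRW two-point function)] -/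
theorem card_nbwWordsTo_eq_sum_coeff_srwP (m : ℕ) (y : Site d) :
    ((nbwWordsTo d m y).card : ℝ) =
      ∑ i ∈ Finset.range ((nbwPoly d m).natDegree + 1),
        (nbwPoly d m).coeff i * (2 * (d : ℝ)) ^ i * srwP d i y := by
  rw [← nbwP_eq_card_nbwWordsTo, nbwP, polyFourier_eq_sum_srwP]

end Literature.Probability.FitznerVanDerHofstad2017
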